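import Summits.BirchSwinnertonDyer.BirchSwinnertonDyer.Theorems.ByReductionTypeAtTwoSupersingularFlatAnnihilatorDivisible
import Summits.BirchSwinnertonDyer.BirchSwinnertonDyer.Theorems.ByReductionTypeAtTwoSupersingularFlatLocalInjectivity
import Summits.BirchSwinnertonDyer.BirchSwinnertonDyer.Theorems.ByReductionTypeAtTwoSupersingularFlatLocalZpGen
import Literature.NumberTheory.EllipticCurves.IwasawaSelmerControlCokerProofs
import Literature.NumberTheory.EllipticCurves.IwasawaSelmerDualProofs
import Literature.NumberTheory.EllipticCurves.PeriodIndexCorestrictionLocal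
import HarnessLib

/-!
# LOC♭ — the ♭-local lift at the place above `p` — is a THEOREM (part 19): `(E♭_∞)_Γ = 0` (part 18) + the
# local `cd_p Γ_𝔭 = 1` (`ZpExtension.exists_extend` along the local `ℤ_p`-extension `κ ∘ res`, part 19a) + the
# Kummer-cocycle plumbing; any number field, any completion, any `p`, explicit Honda clauses

Seat `bsd-2adic-ss-1` GEN 13, crux `SupersingularRankZeroAtTwo` (stmt-BirchSwinnertonDyer-19097, route
`ByReductionTypeAtTwo`, rung K4), line `flat_uniform_two` v1, stub (2) `stub_allFlatData`, conjunct COUNT♭@2 — the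
displayed input `hloc2` of the door `SSFlatEC.flatCountTwo_of_print_of_loc2` (part 15) in its general local form
`exists_localLift_flat`: for `t ∈ H¹(K_∞, E[p^∞])` with `conj_g t − t ∈ E♭_{∞,𝔭}` there is a `p`-power-torsion
`x ∈ H¹(Γ_{K_v}, E(K̄_v))` with `t − res y ∈ E♭_{∞,𝔭}` for EVERY global `y` with `loc_v y = x` (Greenberg LNM 1716
p. 108 «`Gal((F_∞)_η/(F_n)_{v_n})` has `p`-cohomological dimension 1 … for `v ∣ p`», with the ♭ condition). Steps:
cocycle form of the hypothesis; `(E♭_∞)_Γ = 0` (`flatAnnihilator_twist_divisible`); the `E(K̄_v)[p^∞]`-valued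
cocycle `f − ∂Q''` has `conj_g`-invariant class hence extends to `Γ_{K_v}`; any `y` through its class differs
locally by `∂P₁` with `p^N P₁ ∈ E(K_v)`, killed by `Ker Col♭`. HONEST FRAMING: kernel theorem on the tree's
transcription; nothing about any curve is asserted; no census cell moves; BSD is not proved by any of this.

References: [GreenbergLNM1716] §4 proof of Lemma 4.7 p. 108, §3 Lemma 3.2 p. 86; [Sprung2012] Def. 7.9,
Lemma 7.10 (p. 1503); [SerreGaloisCohomology1997] I §2.6 (b).
-/

set_option autoImplicit false
-- the Theorems namespace of this sub repeats the summit name by design (D-0017 nested layout)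
set_option linter.dupNamespace false

noncomputable section

open scoped Classical NumberField

open NumberField IsDedekindDomain Polynomial WeierstrassCurve Literature.NumberTheory.EllipticCurves
  Literature.NumberTheory.GaloisRepresentations Literature.NumberTheory.EllipticCurves.ZpExtension
  Literature.NumberTheory.EllipticCurves.Kobayashi2003 Literature.NumberTheory.EllipticCurves.Sprung2017
  Literature.NumberTheory.EllipticCurves.Sprung2012 Summit.BirchSwinnertonDyer.Rank1Residual.Additive

universe u

namespace Summit.BirchSwinnertonDyer.BirchSwinnertonDyer.Theorems.SSFlatEC

variable {K : Type u} [Field K] [NumberField K] (W : WeierstrassCurve K) [W.IsElliptic] {p : ℕ} [Fact p.Prime]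
  (κ : ZpExtension K p) (E : Type u) [Field E] [CharZero E] [Algebra K E]

set_option maxHeartbeats 1000000 in
/-- **LOC♭ at the place above `p`.** See the module docstring. For `t ∈ H¹(K_∞, E[p^∞])` whose
`conj_g t − t` satisfies the ♭-Kummer condition at the place of `K_∞` above `v` (`E = K_v`), there is a
`p`-power-torsion local class `x ∈ H¹(Γ_{K_v}, E(K̄_v))` such that `t − res y` satisfies the ♭-Kummer condition
for every global `y ∈ H¹(K, E[p^∞])` with `loc_v y = x`.
[cite: GreenbergLNM1716, §4 proof of Lemma 4.7 (p. 108), §3 Lemma 3.2 (p. 86)]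
[cite: Sprung2012, Def. 7.9 and Lemma 7.10 (p. 1503)] -/
theorem exists_localLift_flat {ap : ℤ} (hap : (p : ℤ) ∣ ap) {g : Field.absoluteGaloisGroup E}
    (hg : κ.IsTopGenerator (resGalOfEmb (closureEmb (K := K) E) g))
    {c : ℕ → localPoints W E} (hc : ∀ n, c n ∈ localLayerPointsOfEmb κ (closureEmb (K := K) E) W n)
    (hTr : ∀ n, 1 ≤ n → localTraceOfEmb κ (closureEmb (K := K) E) W n (n + 1) (c (n + 1)) = ap • c n - c (n - 1))
    (hinj : ∀ z₀ : localLayerPointsOfEmb κ (closureEmb (K := K) E) W 0 →+ ℤ_[p],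
      evalOn W (localLayerPointsOfEmb κ (closureEmb (K := K) E) W 0) z₀ (c 0) = 0 → z₀ = 0)
    (hnt : ∀ P ∈ localTowerPointsOfEmb κ (closureEmb (K := K) E) W, p • P = 0 → P = 0)
    (t : W.subgroupH1 p κ.kerSubgroup)
    (ht : W.conjH1 p κ.kerSubgroup (resGalOfEmb (closureEmb (K := K) E) g) t - t ∈
      sharpFlatLocalKummerOverOfEmb W p κ.kerSubgroup (closureEmb (K := K) E) (localTowerPointsOfEmb κ (closureEmb (K := K) E) W)
        (colemanKer κ (closureEmb (K := K) E) W ap g c .flat)) :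
    ∃ xw : discreteH1 (localSubgroup (⊤ : Subgroup (Field.absoluteGaloisGroup K)) E) (localPoints W E), (∃ k : ℕ, p ^ k • xw = 0) ∧
      ∀ y : W.subgroupH1 p (⊤ : Subgroup (Field.absoluteGaloisGroup K)), W.localResOver p ⊤ E y = xw →
        t - W.resOfLe p (le_top : κ.kerSubgroup ≤ ⊤) y ∈ sharpFlatLocalKummerOverOfEmb W p κ.kerSubgroup (closureEmb (K := K) E)
            (localTowerPointsOfEmb κ (closureEmb (K := K) E) W)
            (colemanKer κ (closureEmb (K := K) E) W ap g c .flat) := by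
  set ι : AlgebraicClosure K →ₐ[K] AlgebraicClosure E := closureEmb (K := K) E with hι
  set M : AddSubgroup (localPoints W E) := localTowerPointsOfEmb κ ι W with hM
  set Kset : Set (M →+ ℤ_[p]) := colemanKer κ ι W ap g c .flat with hKset
  haveI : CompactSpace (Field.absoluteGaloisGroup E) := absoluteGaloisGroup_compactSpace E
  haveI : CompactSpace (⊤ : Subgroup (Field.absoluteGaloisGroup K)) := by
    haveI : CompactSpace (Field.absoluteGaloisGroup K) := compactSpace_absoluteGaloisGroup K
    exact isCompact_iff_compactSpace.mp (by rw [Subgroup.coe_top]; exact isCompact_univ)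
  have hle0 : localLayerPointsOfEmb κ ι W 0 ≤ M := localLayerPointsOfEmb_le_localTowerPointsOfEmb κ ι W 0
  have hM0 : ∀ {P : localPoints W E}, P ∈ localLayerPointsOfEmb κ ι W 0 ↔
      ∀ τ : Field.absoluteGaloisGroup E, τ • P = P := fun {P} ↦ mem_localLayerPointsOfEmb_zero_iff κ ι W P
  have hMfix : ∀ {P : localPoints W E}, P ∈ M → ∀ τ : Field.absoluteGaloisGroup E, τ ∈ localSubgroupOfEmb κ.kerSubgroup ι → τ • P = P :=
    fun {P} hP ↦ (mem_localTowerPointsOfEmb_iff κ ι W P).1 hP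
  have hMsmul : ∀ (σ : Field.absoluteGaloisGroup E) {P : localPoints W E}, P ∈ M → σ • P ∈ M :=
    fun σ {P} hP ↦ smul_mem_localTowerPointsOfEmb κ ι W σ hP
  have hconjN : ∀ (σ τ : Field.absoluteGaloisGroup E), τ ∈ localSubgroupOfEmb κ.kerSubgroup ι → σ⁻¹ * τ * σ ∈ localSubgroupOfEmb κ.kerSubgroup ι := by
    intro σ τ hτ
    rw [mem_localSubgroupOfEmb_iff] at hτ ⊢
    rw [map_mul, map_mul, map_inv]
    exact κ.kerSubgroup_normal.conj_mem' _ hτ _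
  have galois_smul_nsmul : ∀ (τ : Field.absoluteGaloisGroup E) (n : ℕ) (P : localPoints W E),
      τ • (n • P) = n • (τ • P) := fun τ n P ↦ map_nsmul (DistribSMul.toAddMonoidHom (localPoints W E) τ) n P
  have hpowtors : ∀ (m : ℕ) {P : localPoints W E}, P ∈ M → p ^ m • P = 0 → P = 0 := by
    intro m
    induction m with
    | zero => intro P _ h; rwa [pow_zero, one_smul] at h
    | succ m ih =>
      intro P hP h
      exact ih hP (hnt _ (AddSubgroup.nsmul_mem _ hP _) (by rw [← mul_smul, ← pow_succ']; exact h))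
  have hGdef : ∀ τ : Field.absoluteGaloisGroup E, τ ∈ localSubgroup κ.kerSubgroup E ↔ τ ∈ localSubgroupOfEmb κ.kerSubgroup ι := fun _ ↦ Iff.rfl
  obtain ⟨κE, hker, hγ⟩ := exists_localZpExtension_of_isTopGenerator κ E (g := g) hg
  have hkerι : ∀ τ : Field.absoluteGaloisGroup E, τ ∈ κE.kerSubgroup ↔ τ ∈ localSubgroupOfEmb κ.kerSubgroup ι := by
    intro τ; rw [hker]; exact hGdef τ
  let T : AddSubgroup (localPoints W E) := AddCommGroup.primaryComponent (localPoints W E) p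
  have hcontT : ∀ x : T, Continuous fun σ : Field.absoluteGaloisGroup E ↦ σ • x := fun x ↦
    (continuous_smul_localPoints W E (x : localPoints W E)).subtype_mk _
  have hprimT : ∀ x : T, ∃ k : ℕ, p ^ k • x = 0 := fun x ↦ by
    obtain ⟨k, hk⟩ := (AddCommGroup.mem_primaryComponent).mp x.2
    exact ⟨k, Subtype.ext (by rw [AddSubgroupClass.coe_nsmul, hk, ZeroMemClass.coe_zero])⟩
  obtain ⟨Φ, rfl⟩ := oneCocycleClass_surjective (discreteTopRep κ.kerSubgroup (W.geomPrimaryTorsion p)) t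
  have hΦtors : ∀ h : κ.kerSubgroup, ∃ k : ℕ, p ^ k • Φ.1 h = 0 := fun h ↦ by
    obtain ⟨k, hk⟩ := AddCommGroup.mem_primaryComponent.mp (Φ.1 h).2
    exact ⟨k, Subtype.ext (by rw [AddSubmonoidClass.coe_nsmul, hk, ZeroMemClass.coe_zero])⟩
  obtain ⟨N, hN⟩ := exists_pow_smul_apply_eq_zero Φ.1 hΦtors
  let resI : ∀ τ : Field.absoluteGaloisGroup E, τ ∈ localSubgroupOfEmb κ.kerSubgroup ι → κ.kerSubgroup :=
    fun τ hτ ↦ resGalSubgroupOfEmb κ.kerSubgroup ι ⟨τ, hτ⟩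
  let f : ∀ τ : Field.absoluteGaloisGroup E, τ ∈ localSubgroupOfEmb κ.kerSubgroup ι → localPoints W E :=
    fun τ hτ ↦ pointsMapOfEmb W ι ((Φ.1 (resI τ hτ) : W.geomPrimaryTorsion p) : W.geomPoints)
  have hfdef : ∀ τ hτ, f τ hτ = pointsMapOfEmb W ι ((Φ.1 (resI τ hτ) : W.geomPrimaryTorsion p) : W.geomPoints) := fun _ _ ↦ rfl
  have hfN : ∀ τ hτ, p ^ N • f τ hτ = 0 := fun τ hτ ↦ by
    rw [hfdef, ← map_nsmul, ← AddSubmonoidClass.coe_nsmul, hN, ZeroMemClass.coe_zero, map_zero]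
  have hfmul : ∀ (σ τ : Field.absoluteGaloisGroup E) (hσ : σ ∈ localSubgroupOfEmb κ.kerSubgroup ι) (hτ : τ ∈ localSubgroupOfEmb κ.kerSubgroup ι),
      f (σ * τ) (mul_mem hσ hτ) = f σ hσ + σ • f τ hτ := by
    intro σ τ hσ hτ
    have hst : resI (σ * τ) (mul_mem hσ hτ) = resI σ hσ * resI τ hτ := Subtype.ext (map_mul _ _ _)
    have h := Φ.2 (resI σ hσ) (resI τ hτ)
    simp only [hfdef]
    rw [hst, h, AddSubgroup.coe_add, map_add, discreteTopRep_ρ_apply, Subgroup.smul_def,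
      primaryComponent.coe_smul, resGalSubgroupOfEmb_apply_coe, pointsMapOfEmb_smul]
  set σ₀ : Field.absoluteGaloisGroup K := resGalOfEmb ι g with hσ₀
  have hcσ : ∀ (x : κ.kerSubgroup) (m : W.geomPrimaryTorsion p), DistribSMul.toAddMonoidHom _ σ₀ (subgroupConj κ.kerSubgroup σ₀ x • m) =
        x • DistribSMul.toAddMonoidHom _ σ₀ m := fun x m ↦ by
    simp only [DistribSMul.toAddMonoidHom_apply, Subgroup.smul_def, subgroupConj_apply_coe, smul_smul,
      mul_assoc, mul_inv_cancel_left]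
  have hconj : W.conjH1 p κ.kerSubgroup σ₀ (oneCocycleClass _ Φ) =
      oneCocycleClass _ (contOneCocycles.pullback (subgroupConj κ.kerSubgroup σ₀)
        (resHomOfEquivariant (subgroupConj κ.kerSubgroup σ₀) (DistribSMul.toAddMonoidHom _ σ₀) hcσ) Φ) :=
    map_oneCocycleClass _ _ _ Φ
  obtain ⟨φ', Q₁, k₁, hQ₁M, hφ', hdiv₁, hcob₁⟩ := ht
  rw [hconj, ← oneCocycleClass_sub, ← sub_eq_zero, ← oneCocycleClass_sub, oneCocycleClass_eq_zero_iff] at hφ'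
  obtain ⟨R₀, hR₀⟩ := hφ'
  have hpb : ∀ h : κ.kerSubgroup, ((contOneCocycles.pullback (subgroupConj κ.kerSubgroup σ₀)
      (resHomOfEquivariant (subgroupConj κ.kerSubgroup σ₀) (DistribSMul.toAddMonoidHom _ σ₀) hcσ) Φ).1 h :
        W.geomPrimaryTorsion p) = σ₀ • Φ.1 (subgroupConj κ.kerSubgroup σ₀ h) := fun h ↦ by
    rw [contOneCocycles.pullback_apply]; rfl
  have hφ'val : ∀ h : κ.kerSubgroup, (φ'.1 h : W.geomPrimaryTorsion p) =
      σ₀ • Φ.1 (subgroupConj κ.kerSubgroup σ₀ h) - Φ.1 h + ((h : Field.absoluteGaloisGroup K) • R₀ - R₀) := by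
    intro h
    have h1 := hR₀ h
    rw [Submodule.coe_sub, ContinuousMap.sub_apply, Submodule.coe_sub, ContinuousMap.sub_apply, hpb,
      discreteTopRep_ρ_apply, Subgroup.smul_def, sub_eq_iff_eq_add] at h1
    rw [h1]
    abel
  obtain ⟨m₀, hm₀⟩ : ∃ m₀ : ℕ, p ^ m₀ • R₀ = 0 := by
    obtain ⟨m, hm⟩ := AddCommGroup.mem_primaryComponent.mp R₀.2
    exact ⟨m, Subtype.ext (by rw [AddSubmonoidClass.coe_nsmul, hm, ZeroMemClass.coe_zero])⟩
  set R₀' : localPoints W E := pointsMapOfEmb W ι ((R₀ : W.geomPrimaryTorsion p) : W.geomPoints) with hR₀'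
  have hR₀'tors : p ^ m₀ • R₀' = 0 := by
    rw [hR₀', ← map_nsmul, ← AddSubmonoidClass.coe_nsmul, hm₀, ZeroMemClass.coe_zero, map_zero]
  obtain ⟨Q₂, hQ₂⟩ : ∃ Q₂ : localPoints W E, Q₂ = Q₁ - R₀' := ⟨_, rfl⟩
  obtain ⟨k₂, hk₂⟩ : ∃ k₂ : ℕ, k₂ = k₁ + m₀ := ⟨_, rfl⟩
  have hx₂eq : p ^ k₂ • Q₂ = p ^ m₀ • (p ^ k₁ • Q₁) := by
    have e1 : p ^ k₂ • R₀' = 0 := by rw [hk₂, pow_add, mul_smul, hR₀'tors, smul_zero]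
    rw [hQ₂, smul_sub, e1, sub_zero, hk₂, pow_add, mul_comm, mul_smul]
  have hx₂M : p ^ k₂ • Q₂ ∈ M := by rw [hx₂eq]; exact AddSubgroup.nsmul_mem _ hQ₁M _
  have hdiv₂ : ∀ z ∈ Kset, (p : ℤ_[p]) ^ k₂ ∣ z ⟨p ^ k₂ • Q₂, hx₂M⟩ := by
    intro z hz
    have h1 : (⟨p ^ k₂ • Q₂, hx₂M⟩ : M) = p ^ m₀ • ⟨p ^ k₁ • Q₁, hQ₁M⟩ := Subtype.ext (by
      rw [AddSubmonoidClass.coe_nsmul]; exact hx₂eq)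
    rw [h1, map_nsmul, nsmul_eq_mul, Nat.cast_pow, hk₂, pow_add, mul_comm ((p : ℤ_[p]) ^ k₁)]
    exact mul_dvd_mul_left _ (hdiv₁ z hz)
  have hgc : ∀ τ (hτ : τ ∈ localSubgroupOfEmb κ.kerSubgroup ι), g⁻¹ * τ * g ∈ localSubgroupOfEmb κ.kerSubgroup ι :=
    fun τ hτ ↦ hconjN g τ hτ
  have htwist : ∀ τ (hτ : τ ∈ localSubgroupOfEmb κ.kerSubgroup ι), g • f (g⁻¹ * τ * g) (hgc τ hτ) - f τ hτ = τ • Q₂ - Q₂ := by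
    intro τ hτ
    have h1 : pointsMapOfEmb W ι ((φ'.1 (resI τ hτ) : W.geomPrimaryTorsion p) : W.geomPoints) = τ • Q₁ - Q₁ := hcob₁ ⟨τ, hτ⟩
    have h2 := hφ'val (resI τ hτ)
    have h3 : subgroupConj κ.kerSubgroup σ₀ (resI τ hτ) = resI (g⁻¹ * τ * g) (hgc τ hτ) := Subtype.ext (by
      rw [subgroupConj_apply_coe, hσ₀]
      change _ = resGalOfEmb ι (g⁻¹ * τ * g)
      rw [map_mul, map_mul, map_inv]; rfl)
    have hres : ((resI τ hτ : κ.kerSubgroup) : Field.absoluteGaloisGroup K) = resGalOfEmb ι τ := rfl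
    have h6 : pointsMapOfEmb W ι ((φ'.1 (resI τ hτ) : W.geomPrimaryTorsion p) : W.geomPoints) =
        g • f (g⁻¹ * τ * g) (hgc τ hτ) - f τ hτ + (τ • R₀' - R₀') := by
      rw [h2, h3, AddSubgroup.coe_add, AddSubgroup.coe_sub, AddSubgroup.coe_sub, map_add, map_sub, map_sub,
        primaryComponent.coe_smul, primaryComponent.coe_smul, hσ₀, pointsMapOfEmb_smul, hres,
        pointsMapOfEmb_smul]
    have h7 : g • f (g⁻¹ * τ * g) (hgc τ hτ) - f τ hτ + (τ • R₀' - R₀') = τ • Q₁ - Q₁ := h6.symm.trans h1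
    rw [hQ₂, smul_sub]
    calc g • f (g⁻¹ * τ * g) (hgc τ hτ) - f τ hτ
        = (g • f (g⁻¹ * τ * g) (hgc τ hτ) - f τ hτ + (τ • R₀' - R₀')) - (τ • R₀' - R₀') := by abel
      _ = (τ • Q₁ - Q₁) - (τ • R₀' - R₀') := by rw [h7]
      _ = τ • Q₁ - τ • R₀' - (Q₁ - R₀') := by abel
  obtain ⟨x', k', m, hx'K, hrel⟩ := flatAnnihilator_twist_divisible κ ι W hap hg hc hTr hnt ⟨p ^ k₂ • Q₂, hx₂M⟩ k₂ hdiv₂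
  set x'' : localPoints W E := -(g⁻¹ • (x' : localPoints W E)) with hx''
  have hx''M : x'' ∈ M := M.neg_mem (hMsmul g⁻¹ x'.2)
  have hgx'' : g • x'' - x'' = g⁻¹ • (x' : localPoints W E) - x' := by
    rw [hx'', smul_neg, smul_inv_smul]; abel
  have hpk' : ((p ^ k' : ℕ) : ℤ) ≠ 0 := by exact_mod_cast pow_ne_zero _ (Fact.out : p.Prime).ne_zero
  obtain ⟨Q'', hQ''⟩ : ∃ Q'' : localPoints W E, ((p ^ k' : ℕ) : ℤ) • Q'' = x'' :=
    (W.baseChange (AlgebraicClosure E)).zsmul_surjective_of_isAlgClosed hpk' x''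
  rw [natCast_zsmul] at hQ''
  obtain ⟨P, hPdef⟩ : ∃ P : localPoints W E, P = Q₂ - (g • Q'' - Q'') - (m : localPoints W E) := ⟨_, rfl⟩
  have hPtors : p ^ (k₂ + k') • P = 0 := by
    have h1 : (((p ^ k' • (⟨p ^ k₂ • Q₂, hx₂M⟩ : M) - p ^ k₂ •
        ((⟨g⁻¹ • (x' : localPoints W E), smul_mem_localTowerPointsOfEmb κ ι W g⁻¹ x'.2⟩ : M) - x') : M)) :
        localPoints W E) = ((p ^ (k₂ + k') • m : M) : localPoints W E) := by rw [hrel]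
    simp only [AddSubgroup.coe_sub, AddSubgroupClass.coe_nsmul] at h1
    have e1 : p ^ (k₂ + k') • Q₂ = p ^ k' • (p ^ k₂ • Q₂) := by rw [pow_add, mul_comm, mul_smul]
    have e2 : p ^ (k₂ + k') • (g • Q'' - Q'') = p ^ k₂ • (g⁻¹ • (x' : localPoints W E) - x') := by
      rw [pow_add, mul_smul, smul_sub (p ^ k'), ← galois_smul_nsmul, hQ'', hgx'']
    rw [hPdef, smul_sub, smul_sub, e1, e2, ← h1]
    exact sub_self _
  let P' : T := ⟨P, (AddCommGroup.mem_primaryComponent).mpr ⟨k₂ + k', hPtors⟩⟩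
  have hk : ∀ τ : κE.kerSubgroup, (τ : Field.absoluteGaloisGroup E) ∈ localSubgroupOfEmb κ.kerSubgroup ι :=
    fun τ ↦ (hkerι τ).mp τ.2
  have hKum0 : ∀ τ : κE.kerSubgroup, p ^ k' • ((τ : Field.absoluteGaloisGroup E) • Q'' - Q'') = 0 := by
    intro τ
    rw [smul_sub, ← galois_smul_nsmul, hQ'', hMfix hx''M _ (hk τ), sub_self]
  have hcTmem : ∀ τ : κE.kerSubgroup, f τ (hk τ) - ((τ : Field.absoluteGaloisGroup E) • Q'' - Q'') ∈ T := fun τ ↦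
    (AddCommGroup.mem_primaryComponent).mpr ⟨N + k', by
      rw [smul_sub, pow_add, mul_smul, mul_smul, hKum0, smul_zero, sub_zero, smul_comm (p ^ N) (p ^ k'), hfN, smul_zero]⟩
  have hfcont : Continuous fun τ : κE.kerSubgroup ↦ f τ (hk τ) := by
    have h1 : Continuous fun τ : κE.kerSubgroup ↦ resI τ (hk τ) :=
      (((map_continuous (resGalOfEmb ι)).comp continuous_subtype_val).subtype_mk _)
    exact (continuous_of_discreteTopology (f := fun P : W.geomPrimaryTorsion p ↦ pointsMapOfEmb W ι (P : W.geomPoints))).comp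
      (Φ.1.continuous.comp h1)
  have hKcont : Continuous fun τ : κE.kerSubgroup ↦ (τ : Field.absoluteGaloisGroup E) • Q'' - Q'' :=
    (continuous_of_discreteTopology (f := fun q : localPoints W E ↦ q - Q'')).comp
      ((continuous_smul_localPoints W E Q'').comp continuous_subtype_val)
  let cT : contOneCocycles (discreteTopRep κE.kerSubgroup T) :=
    ⟨⟨fun τ ↦ ⟨f τ (hk τ) - ((τ : Field.absoluteGaloisGroup E) • Q'' - Q''), hcTmem τ⟩,
      ((continuous_of_discreteTopology (f := fun q : localPoints W E × localPoints W E ↦ q.1 - q.2)).comp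
        (hfcont.prodMk hKcont)).subtype_mk _⟩, fun σ τ ↦ by
      apply Subtype.ext
      change f (σ * τ : κE.kerSubgroup) (hk _) - (((σ * τ : κE.kerSubgroup) : Field.absoluteGaloisGroup E) • Q'' - Q'') =
        (f σ (hk σ) - ((σ : Field.absoluteGaloisGroup E) • Q'' - Q'')) +
          (σ : Field.absoluteGaloisGroup E) • (f τ (hk τ) - ((τ : Field.absoluteGaloisGroup E) • Q'' - Q''))
      have e1 : f (σ * τ : κE.kerSubgroup) (hk _) = f σ (hk σ) + (σ : Field.absoluteGaloisGroup E) • f τ (hk τ) :=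
        hfmul σ τ (hk σ) (hk τ)
      rw [e1, Subgroup.coe_mul, mul_smul, smul_sub, smul_sub]
      abel⟩
  have hcT : ∀ τ : κE.kerSubgroup,
      ((cT.1 τ : T) : localPoints W E) = f τ (hk τ) - ((τ : Field.absoluteGaloisGroup E) • Q'' - Q'') :=
    fun _ ↦ rfl
  have hm : ∀ τ : κE.kerSubgroup, g ^ p ^ 0 • cT.1 (subgroupConj κE.kerSubgroup (g ^ p ^ 0) τ) - cT.1 τ =
        (τ : Field.absoluteGaloisGroup E) • P' - P' := by
    intro τ
    have hg1 : g ^ p ^ 0 = g := by rw [pow_zero, pow_one]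
    have hconjτ : subgroupConj κE.kerSubgroup (g ^ p ^ 0) τ =
        ⟨g⁻¹ * τ * g, (hkerι _).mpr (hgc τ (hk τ))⟩ := Subtype.ext (by rw [subgroupConj_apply_coe, hg1])
    apply Subtype.ext
    rw [hconjτ, hg1, AddSubgroup.coe_sub, primaryComponent.coe_smul, hcT, hcT, AddSubgroup.coe_sub, primaryComponent.coe_smul]
    change g • (f (g⁻¹ * τ * g) (hgc τ (hk τ)) - ((g⁻¹ * τ * g) • Q'' - Q'')) -
      (f τ (hk τ) - ((τ : Field.absoluteGaloisGroup E) • Q'' - Q'')) = (τ : Field.absoluteGaloisGroup E) • P - P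
    have e1 := htwist τ (hk τ)
    have e2 : g • ((g⁻¹ * (τ : Field.absoluteGaloisGroup E) * g) • Q'') = (τ : Field.absoluteGaloisGroup E) • g • Q'' := by
      rw [← mul_smul, ← mul_smul, ← mul_assoc, ← mul_assoc, mul_inv_cancel, one_mul]
    have e3 : (τ : Field.absoluteGaloisGroup E) • (m : localPoints W E) = m := hMfix m.2 _ (hk τ)
    have hτP : (τ : Field.absoluteGaloisGroup E) • P =
        (τ : Field.absoluteGaloisGroup E) • Q₂ - ((τ : Field.absoluteGaloisGroup E) • g • Q'' -
          (τ : Field.absoluteGaloisGroup E) • Q'') - (m : localPoints W E) := by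
      rw [hPdef, smul_sub, smul_sub, smul_sub, e3]
    rw [smul_sub g, smul_sub g, e2, hτP, hPdef]
    calc g • f (g⁻¹ * τ * g) (hgc τ (hk τ)) - ((τ : Field.absoluteGaloisGroup E) • g • Q'' - g • Q'') -
          (f τ (hk τ) - ((τ : Field.absoluteGaloisGroup E) • Q'' - Q''))
        = (g • f (g⁻¹ * τ * g) (hgc τ (hk τ)) - f τ (hk τ)) -
            ((τ : Field.absoluteGaloisGroup E) • g • Q'' - g • Q'') + ((τ : Field.absoluteGaloisGroup E) • Q'' - Q'') := by abel
      _ = ((τ : Field.absoluteGaloisGroup E) • Q₂ - Q₂) -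
            ((τ : Field.absoluteGaloisGroup E) • g • Q'' - g • Q'') + ((τ : Field.absoluteGaloisGroup E) • Q'' - Q'') := by rw [e1]
      _ = (τ : Field.absoluteGaloisGroup E) • Q₂ - ((τ : Field.absoluteGaloisGroup E) • g • Q'' -
            (τ : Field.absoluteGaloisGroup E) • Q'') - (m : localPoints W E) -
            (Q₂ - (g • Q'' - Q'') - (m : localPoints W E)) := by abel
  obtain ⟨b, hb⟩ := ZpExtension.exists_extend κE hγ 0 hcontT hprimT cT P' hm
  haveI : CompactSpace (κE.layerSubgroup 0) :=
    isCompact_iff_compactSpace.mp (Subgroup.isClosed_of_isOpen _ (κE.isOpen_layerSubgroup 0)).isCompact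
  obtain ⟨Nb, hNb⟩ := exists_pow_smul_apply_eq_zero b.1 (fun h ↦ hprimT _)
  have hθ : localSubgroup (⊤ : Subgroup (Field.absoluteGaloisGroup K)) E ≤ κE.layerSubgroup 0 :=
    fun σ _ ↦ by rw [ZpExtension.layerSubgroup_zero]; exact Subgroup.mem_top σ
  have hθc : ∀ (x : localSubgroup (⊤ : Subgroup (Field.absoluteGaloisGroup K)) E) (m : T),
      T.subtype (subgroupInclusion hθ x • m) = x • T.subtype m := fun _ _ ↦ rfl
  set xw : discreteH1 (localSubgroup (⊤ : Subgroup (Field.absoluteGaloisGroup K)) E) (localPoints W E) :=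
    resH1Hom (subgroupInclusion hθ) T.subtype hθc (oneCocycleClass _ b) with hxw
  refine ⟨xw, ⟨Nb, ?_⟩, fun y hy ↦ ?_⟩
  · have hb0 : p ^ Nb • b = 0 := Subtype.ext (by ext h; exact congrArg Subtype.val (hNb h))
    rw [hxw, ← map_nsmul, ← oneCocycleClassₗ_apply, ← map_nsmul, hb0, map_zero, map_zero]
  obtain ⟨Ψ, rfl⟩ := oneCocycleClass_surjective _ y
  obtain ⟨NΨ, hNΨ⟩ := exists_pow_smul_apply_eq_zero Ψ.1 (fun h ↦ by
    obtain ⟨k, hk⟩ := AddCommGroup.mem_primaryComponent.mp (Ψ.1 h).2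
    exact ⟨k, Subtype.ext (by rw [AddSubmonoidClass.coe_nsmul, hk, ZeroMemClass.coe_zero])⟩)
  have hcompatΨ : ∀ (τ : localSubgroup (⊤ : Subgroup (Field.absoluteGaloisGroup K)) E) (P : W.geomPrimaryTorsion p),
      ((pointsMapOfEmb W ι).comp (W.geomPrimaryTorsion p).subtype)
        (resGalSubgroup (⊤ : Subgroup (Field.absoluteGaloisGroup K)) E τ • P) =
      τ • ((pointsMapOfEmb W ι).comp (W.geomPrimaryTorsion p).subtype) P := fun τ P ↦ by
    simp only [AddMonoidHom.coe_comp, AddSubgroup.coe_subtype, Function.comp_apply, Subgroup.smul_def,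
      resGalSubgroup_apply_coe, primaryComponent.coe_smul]
    exact pointsMapOfEmb_smul W ι τ P
  have hyL : W.localResOver p ⊤ E (oneCocycleClass _ Ψ) =
      oneCocycleClass (discreteTopRep (localSubgroup (⊤ : Subgroup (Field.absoluteGaloisGroup K)) E)
        (localPoints W E)) (contOneCocycles.pullback (resGalSubgroup ⊤ E)
        (resHomOfEquivariant (resGalSubgroup ⊤ E) ((pointsMapOfEmb W ι).comp (W.geomPrimaryTorsion p).subtype) hcompatΨ) Ψ) :=
    map_oneCocycleClass _ _ _ Ψ
  have hxwL : xw = oneCocycleClass _ (contOneCocycles.pullback (subgroupInclusion hθ)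
      (resHomOfEquivariant (subgroupInclusion hθ) T.subtype hθc) b) := map_oneCocycleClass _ _ _ b
  rw [hyL, hxwL, ← sub_eq_zero, ← oneCocycleClass_sub, oneCocycleClass_eq_zero_iff] at hy
  obtain ⟨P₁, hP₁⟩ := hy
  have hP₁val : ∀ δ : localSubgroup (⊤ : Subgroup (Field.absoluteGaloisGroup K)) E,
      pointsMapOfEmb W ι ((Ψ.1 (resGalSubgroup ⊤ E δ) : W.geomPrimaryTorsion p) : W.geomPoints) -
        ((b.1 (subgroupInclusion hθ δ) : T) : localPoints W E) =
      (δ : Field.absoluteGaloisGroup E) • P₁ - P₁ := fun δ ↦ by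
    have h := hP₁ δ
    rw [Submodule.coe_sub, ContinuousMap.sub_apply, contOneCocycles.pullback_apply,
      contOneCocycles.pullback_apply, discreteTopRep_ρ_apply, Subgroup.smul_def] at h
    exact h
  set N₁ : ℕ := NΨ + Nb with hN₁
  have hmemTop : ∀ σ : Field.absoluteGaloisGroup E, σ ∈ localSubgroup (⊤ : Subgroup (Field.absoluteGaloisGroup K)) E := fun σ ↦
    (mem_localSubgroup_iff ⊤ E σ).mpr (Subgroup.mem_top _)
  have hP₁0 : p ^ N₁ • P₁ ∈ localLayerPointsOfEmb κ ι W 0 := by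
    rw [hM0]
    intro σ
    have h := hP₁val ⟨σ, hmemTop σ⟩
    have hA : p ^ NΨ • pointsMapOfEmb W ι ((Ψ.1 (resGalSubgroup ⊤ E ⟨σ, hmemTop σ⟩) :
        W.geomPrimaryTorsion p) : W.geomPoints) = 0 := by
      rw [← map_nsmul, ← AddSubmonoidClass.coe_nsmul, hNΨ, ZeroMemClass.coe_zero, map_zero]
    have hB : p ^ Nb • (((b.1 (subgroupInclusion hθ ⟨σ, hmemTop σ⟩)) : T) : localPoints W E) = 0 := by
      rw [← AddSubgroupClass.coe_nsmul, hNb, ZeroMemClass.coe_zero]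
    have h1 : p ^ N₁ • ((σ : Field.absoluteGaloisGroup E) • P₁ - P₁) = 0 := by
      have h' := hP₁val ⟨σ, hmemTop σ⟩
      rw [← h', smul_sub, hN₁, pow_add, mul_smul, mul_smul, smul_comm (p ^ NΨ) (p ^ Nb), hB, hA, smul_zero, smul_zero, sub_zero]
    rw [smul_sub, ← galois_smul_nsmul, sub_eq_zero] at h1
    exact h1
  have hres : W.resOfLe p (le_top : κ.kerSubgroup ≤ ⊤) (oneCocycleClass _ Ψ) =
      oneCocycleClass _ (contOneCocycles.pullback (subgroupInclusion (le_top : κ.kerSubgroup ≤ ⊤))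
        (resHomOfEquivariant (subgroupInclusion (le_top : κ.kerSubgroup ≤ ⊤))
          (AddMonoidHom.id (W.geomPrimaryTorsion p)) (fun _ _ ↦ rfl)) Ψ) :=
    map_oneCocycleClass _ _ _ Ψ
  rw [hres, ← oneCocycleClass_sub, mem_sharpFlatLocalKummerOverOfEmb_iff]
  have hQfinM : p ^ (k' + N₁) • (Q'' - P₁) ∈ M := by
    rw [smul_sub, pow_add, mul_smul, mul_smul, smul_comm (p ^ k') (p ^ N₁) Q'', hQ'']
    exact M.sub_mem (M.nsmul_mem hx''M _) (M.nsmul_mem (hle0 hP₁0) _)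
  have hx''K : ∀ z ∈ Kset, (p : ℤ_[p]) ^ k' ∣ z ⟨x'', hx''M⟩ := by
    intro z hz
    let σg : M →+ M := AddMonoidHom.mk' (fun y ↦ ⟨g⁻¹ • (y : localPoints W E),
      smul_mem_localTowerPointsOfEmb κ ι W g⁻¹ y.2⟩) (fun a b ↦ Subtype.ext (by simp [smul_add]))
    have hzg : z.comp σg ∈ Kset :=
      (mem_colemanKer_flat_twist_iff κ ι W hap hg hc hTr (z := z) (z' := z.comp σg) (fun _ ↦ rfl)).mpr hz
    have h1 := hx'K _ hzg
    have h2 : (⟨x'', hx''M⟩ : M) = -σg x' := Subtype.ext (by rw [AddSubgroup.coe_neg]; rfl)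
    rw [h2, map_neg, dvd_neg]
    exact h1
  have hdivfin : ∀ z ∈ Kset, (p : ℤ_[p]) ^ (k' + N₁) ∣ z ⟨p ^ (k' + N₁) • (Q'' - P₁), hQfinM⟩ := by
    intro z hz
    have h1 : (⟨p ^ (k' + N₁) • (Q'' - P₁), hQfinM⟩ : M) =
        p ^ N₁ • ⟨x'', hx''M⟩ - p ^ k' • ⟨p ^ N₁ • P₁, hle0 hP₁0⟩ := Subtype.ext (by
      simp only [AddSubgroup.coe_sub, AddSubgroupClass.coe_nsmul]
      rw [smul_sub, pow_add, mul_smul, mul_smul, smul_comm (p ^ k') (p ^ N₁) Q'', hQ''])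
    rw [h1, map_sub, map_nsmul, map_nsmul,
      apply_layer_zero_eq_zero_of_mem_colemanKer_flat (hc 0) hinj hz hP₁0, smul_zero, sub_zero,
      nsmul_eq_mul, Nat.cast_pow, pow_add, mul_comm ((p : ℤ_[p]) ^ k')]
    exact mul_dvd_mul_left _ (hx''K z hz)
  refine ⟨Φ - contOneCocycles.pullback (subgroupInclusion (le_top : κ.kerSubgroup ≤ ⊤))
      (resHomOfEquivariant (subgroupInclusion (le_top : κ.kerSubgroup ≤ ⊤))
        (AddMonoidHom.id (W.geomPrimaryTorsion p)) (fun _ _ ↦ rfl)) Ψ,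
    Q'' - P₁, k' + N₁, hQfinM, rfl, hdivfin, fun τ ↦ ?_⟩
  have hτE : (τ : Field.absoluteGaloisGroup E) ∈ κE.kerSubgroup := (hkerι _).mpr τ.2
  have hbτ := hb τ hτE
  have h7 := hP₁val ⟨τ, hmemTop τ⟩
  have e1 : (b.1 (subgroupInclusion hθ ⟨(τ : Field.absoluteGaloisGroup E), hmemTop τ⟩) : T) =
      b.1 ⟨τ, κE.kerSubgroup_le_layerSubgroup 0 hτE⟩ := rfl
  rw [e1, hbτ, hcT] at h7
  have e2 : (Ψ.1 (resGalSubgroup ⊤ E ⟨(τ : Field.absoluteGaloisGroup E), hmemTop τ⟩) : W.geomPrimaryTorsion p) =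
      Ψ.1 (subgroupInclusion (le_top : κ.kerSubgroup ≤ ⊤) (resGalSubgroupOfEmb κ.kerSubgroup ι τ)) :=
    congrArg _ (Subtype.ext rfl)
  rw [e2] at h7
  have e3 : f τ (hk ⟨τ, hτE⟩) = pointsMapOfEmb W ι ((Φ.1 (resGalSubgroupOfEmb κ.kerSubgroup ι τ) :
      W.geomPrimaryTorsion p) : W.geomPoints) := by
    rw [hfdef]
  rw [Submodule.coe_sub, ContinuousMap.sub_apply, contOneCocycles.pullback_apply, AddSubgroup.coe_sub, map_sub]
  change pointsMapOfEmb W ι ((Φ.1 (resGalSubgroupOfEmb κ.kerSubgroup ι τ) : W.geomPrimaryTorsion p) :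
      W.geomPoints) - pointsMapOfEmb W ι ((Ψ.1 (subgroupInclusion (le_top : κ.kerSubgroup ≤ ⊤)
        (resGalSubgroupOfEmb κ.kerSubgroup ι τ)) : W.geomPrimaryTorsion p) : W.geomPoints) =
    (τ : Field.absoluteGaloisGroup E) • (Q'' - P₁) - (Q'' - P₁)
  rw [← e3]
  rw [sub_eq_iff_eq_add] at h7
  rw [h7, smul_sub]
  abel

end Summit.BirchSwinnertonDyer.BirchSwinnertonDyer.Theorems.SSFlatEC

end
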